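import Mathlib
import Summits.ValiantsHypothesis.ValiantsHypothesis.Theorems.RigidityForcesSymmetryRankRigidMinimalReprLaplaceFiveOnShellCaseA
import Summits.ValiantsHypothesis.ValiantsHypothesis.Theorems.RigidityForcesSymmetryRankRigidMinimalReprLaplaceFiveOnShellCover
import Summits.ValiantsHypothesis.ValiantsHypothesis.Theorems.RigidityForcesSymmetryRankRigidMinimalReprLaplaceFiveOnShellNoJunkB

/-!
# ValiantsHypothesis / RigidityForcesSymmetry — crux `LaplaceOptimalFive` (stmt-ValiantsHypothesis-24813), line
`Cruxes/LaplaceOptimalFive/Lines/shallow_collision.lean` («shallow-collision ledger»): CLOSER of stub S1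
`stub_onShell_five` — **on-shell cylindrical exact term systems for `P₅` have Laplace weight `≥ 120`.**

`onShell_five` is the line's g4-K2 form `Cylindrical S u w → OnShellAll S u w → exact → 5! ≤ weight T S` with the
line's vocabulary UNFOLDED (`Cylindrical` = the two cylinder clauses, `OnShellAll` = the four on-shell clauses for
all `t`, `weight T S = ∑ t ∈ T, |S t|!·(5−|S t|)!`); the line's proved bridge `onShell_five_of_onShellAll_five`
converts it to the registered S1 (`OnShell T S u w` relativised to `t ∈ T`).

Proof (files `…LaplaceFiveOnShell{Basics,Canon,CanonTwo,JunkCount,JunkTransport,Junk,EqnsA,EqnsB,CaseA,Cover,NoJunkA,NoJunkB}`):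
a term on the empty/full slot set alone weighs `120`; otherwise, with the choice functions `F, G`
(`u t v = F t ((S t).image v)`, …) and the flattening sums `Y ω (S₀, Q)`, EITHER some word `ω` with `ω 0 = ω 1` has
a nonzero depth-one flattening sum — then the 28 load-bearing exactness equations at the words `ω ∘ ρ` and LEMMA J
(`junk_dichotomy`: the `x`-dependence is the same on all ten pair flattenings; in the `x`-independent case the
pair entries are `−β p − β q + Σβ/3` and `junk_count` applies) give occupied flattenings of total weight `≥ 120`
(`weight_ge_of_junk`) — OR all of them vanish, and then on every flattening the number of terms dominates the
number of supported letter sets (linear independence tested on mixed words) while exactness at the `120`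
permutation words makes the supported blocks cover `S₅` (`weight_ge_of_noJunk`).

Honest framing.  This closes S1 of the line ONLY (the on-shell case).  The proof is `d = 5` bookkeeping (the junk
system is solved for five slots and `S₀ ≠ S₀ᶜ` uses that `5` is odd); the METHOD is `d`-uniform but the `d = 6`
on-shell statement is NOT proved here.  S2/S3 of the line, `LaplaceOptimalFive` (stmt-24813, OPEN · CONTESTED
72/120), `RankRigidMinimalRepr` and `VP ≠ VNP` are NOT proved by any of this.  No definitions, no `sorry`; Mathlib only.
-/

set_option linter.dupNamespace false

namespace Summit.ValiantsHypothesis.ValiantsHypothesis.Theorems.RigidityForcesSymmetryRankRigidMinimalRepr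

namespace LaplaceFiveOnShell

open Finset

/-- **S1 `stub_onShell_five` (g4-K2 / `OnShellAll` form, line vocabulary unfolded): an on-shell cylindrical term
system reproducing `P₅` exactly has Laplace weight at least `5! = 120`.** [folklore] -/
theorem onShell_five :
    ∀ (N : ℕ) (T : Finset (Fin N)) (S : Fin N → Finset (Fin 5)) (u w : Fin N → (Fin 5 → Fin 5) → ℂ),
      ((∀ t, ∀ v v' : Fin 5 → Fin 5, (∀ i ∈ S t, v i = v' i) → u t v = u t v') ∧
        (∀ t, ∀ v v' : Fin 5 → Fin 5, (∀ i, i ∉ S t → v i = v' i) → w t v = w t v')) →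
      ((∀ t v, ((S t).image v).card < (S t).card → u t v = 0) ∧
        (∀ t v v', (S t).image v = (S t).image v' → u t v = u t v') ∧
        (∀ t v, (((S t)ᶜ).image v).card < ((S t)ᶜ).card → w t v = 0) ∧
        (∀ t v v', ((S t)ᶜ).image v = ((S t)ᶜ).image v' → w t v = w t v')) →
      (∀ v : Fin 5 → Fin 5, (∑ t ∈ T, u t v * w t v) = if Function.Injective v then 1 else 0) →
      Nat.factorial 5 ≤ ∑ t ∈ T, (S t).card.factorial * (5 - (S t).card).factorial := by
  intro N T S u w _hcyl hon hid
  classical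
  obtain ⟨ho1, ho2, ho3, ho4⟩ := hon
  by_cases htriv : ∃ t ∈ T, S t = ∅ ∨ S t = Finset.univ
  · obtain ⟨t, ht, h⟩ := htriv
    exact weight_ge_of_trivial_split T S t ht h
  push Not at htriv
  obtain ⟨F, hF⟩ := exists_F S u ho2
  obtain ⟨G, hG⟩ := exists_G S w ho4
  set Y : (Fin 5 → Fin 5) → Finset (Fin 5) × Finset (Fin 5) → ℂ :=
    fun (ω' : Fin 5 → Fin 5) (e : Finset (Fin 5) × Finset (Fin 5)) =>
      (∑ t ∈ T.filter (fun t => S t = e.1),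
          F t (e.2.image ω') * G t ((insert (0 : Fin 5) (({0, 2, 3, 4} : Finset (Fin 5)) \ e.2)).image ω'))
        + ∑ t ∈ T.filter (fun t => S t = e.1ᶜ),
          F t ((insert (0 : Fin 5) (({0, 2, 3, 4} : Finset (Fin 5)) \ e.2)).image ω') * G t (e.2.image ω') with hYdef
  have hY : ∀ (ω' : Fin 5 → Fin 5) (S₀ Q : Finset (Fin 5)), Y ω' (S₀, Q)
      = (∑ t ∈ T.filter (fun t => S t = S₀),
          F t (Q.image ω') * G t ((insert (0 : Fin 5) (({0, 2, 3, 4} : Finset (Fin 5)) \ Q)).image ω'))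
        + ∑ t ∈ T.filter (fun t => S t = S₀ᶜ),
          F t ((insert (0 : Fin 5) (({0, 2, 3, 4} : Finset (Fin 5)) \ Q)).image ω') * G t (Q.image ω') :=
    fun _ _ _ => rfl
  by_cases hA : ∃ ω : Fin 5 → Fin 5, ω 0 = ω 1 ∧ ¬ ((∀ p : Fin 5, Y ω ({p}, {0}) = 0) ∧ Y ω ({0, 1}, {0, 2}) = 0 ∧ Y ω
      ({0, 1}, {0, 3}) = 0 ∧ Y ω ({0, 1}, {0, 4}) = 0 ∧ Y ω ({0, 2}, {0, 2}) = 0 ∧ Y ω ({0, 2}, {0, 3}) = 0 ∧ Y ω ({0,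
      2}, {0, 4}) = 0 ∧ Y ω ({0, 3}, {0, 2}) = 0 ∧ Y ω ({0, 3}, {0, 3}) = 0 ∧ Y ω ({0, 3}, {0, 4}) = 0 ∧ Y ω ({0, 4},
      {0, 2}) = 0 ∧ Y ω ({0, 4}, {0, 3}) = 0 ∧ Y ω ({0, 4}, {0, 4}) = 0 ∧ Y ω ({1, 2}, {0, 2}) = 0 ∧ Y ω ({1, 2}, {0,
      3}) = 0 ∧ Y ω ({1, 2}, {0, 4}) = 0 ∧ Y ω ({1, 3}, {0, 2}) = 0 ∧ Y ω ({1, 3}, {0, 3}) = 0 ∧ Y ω ({1, 3}, {0, 4})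
      = 0 ∧ Y ω ({1, 4}, {0, 2}) = 0 ∧ Y ω ({1, 4}, {0, 3}) = 0 ∧ Y ω ({1, 4}, {0, 4}) = 0 ∧ Y ω ({2, 3}, {0, 2}) = 0
      ∧ Y ω ({2, 3}, {0, 3}) = 0 ∧ Y ω ({2, 3}, {0, 4}) = 0 ∧ Y ω ({2, 4}, {0, 2}) = 0 ∧ Y ω ({2, 4}, {0, 3}) = 0 ∧ Y
      ω ({2, 4}, {0, 4}) = 0 ∧ Y ω ({3, 4}, {0, 2}) = 0 ∧ Y ω ({3, 4}, {0, 3}) = 0 ∧ Y ω ({3, 4}, {0, 4}) = 0)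
  · obtain ⟨ω, hω, hnz⟩ := hA
    exact weight_ge_of_junk T S u w ho1 ho3 hid F G hF hG Y hY ω hω hnz
  · push Not at hA
    refine weight_ge_of_noJunk T S u w hid ho2 ho4
      (fun t ht => ⟨Finset.nonempty_iff_ne_empty.mp (htriv t ht).1, (htriv t ht).2⟩) ?_
    intro S₀ hS₀
    simp only [Finset.mem_insert, Finset.mem_singleton] at hS₀
    rcases hS₀ with rfl | rfl | rfl | rfl | rfl | rfl | rfl | rfl | rfl | rfl | rfl | rfl | rfl | rfl | rfl
    · exact noJunk_0 T S u w F G hF hG Y hY hA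
    · exact noJunk_1 T S u w F G hF hG Y hY hA
    · exact noJunk_2 T S u w F G hF hG Y hY hA
    · exact noJunk_3 T S u w F G hF hG Y hY hA
    · exact noJunk_4 T S u w F G hF hG Y hY hA
    · exact noJunk_01 T S u w F G hF hG Y hY hA
    · exact noJunk_02 T S u w F G hF hG Y hY hA
    · exact noJunk_03 T S u w F G hF hG Y hY hA
    · exact noJunk_04 T S u w F G hF hG Y hY hA
    · exact noJunk_12 T S u w F G hF hG Y hY hA
    · exact noJunk_13 T S u w F G hF hG Y hY hA
    · exact noJunk_14 T S u w F G hF hG Y hY hA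
    · exact noJunk_23 T S u w F G hF hG Y hY hA
    · exact noJunk_24 T S u w F G hF hG Y hY hA
    · exact noJunk_34 T S u w F G hF hG Y hY hA

end LaplaceFiveOnShell

end Summit.ValiantsHypothesis.ValiantsHypothesis.Theorems.RigidityForcesSymmetryRankRigidMinimalRepr
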